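import Summits.QuantumFields.YangMills.Theorems.BalabanUVNodesN12MinimiserFamilyAtRecordBjTowerThresholdUniform
import Summits.QuantumFields.YangMills.Theorems.BalabanUVNodesN12Thm1RowAtFlatDatum
import Summits.QuantumFields.YangMills.Theorems.BalabanUVNodesN12HsurjOfClass
import HarnessLib

/-!
# BalabanUVNodes ∕ N12 — «(J0′) OF RECORD» AT THE FLAT BASE FIELD: [IV] Prop. 1's ANALYTIC FAMILY OF (2.12) MINIMISERS FOR ALL DATA NEAR `V_k ≡ 1`, BY NAME, WITH NOTHING
# DISPLAYED BUT THE RECORD NUMERICS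
# ([Balaban1989LargeFieldI] (1.74) p.192, p.193 ll.14–20, Prop. 1 p.194; [Balaban1985Variational] (2)–(4),(7) p.278, Thm 1 p.279, Sect. C (44)–(48) p.285, (81)–(83) p.290, Sect. G
# pp.305–307, (181) p.307, Prop. 9 (190) p.309; [Balaban1985RegularSpaces] (1.7), (1.9) p.77; [Balaban1989LargeFieldII] p.357, (1.7)–(1.9) p.358, (1.12)–(1.13) p.359;
# [Balaban1988Convergent] (2.2) p.255, (2.10)–(2.13) pp.256–257; [Balaban1985Averaging] Prop. 2 (52)–(54) p.26, (122)–(126) p.36; [Balaban1987RG1] (0.2), (0.4) pp.252–253)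

Cell `pub-ymgap` (HUMAN RULINGS D-0062 ∕ D-0149), seat `pub-ymgap-dag-n12-d` g25 (R134 N12 [B15] s2 = by-name knit at the record; census item E1 = the (J0′) row; count-neutral helper of K1⁹
`stmt-QuantumFields-27364`, `--kind proof --supports … --as helper`).  THEOREMS ONLY (0 `def`, 0 `instance`, 0 `sorry`); compositions BY NAME.

WHAT.  The (J0′) producer of record (the lane's εreg-uniform U2 `N12MinimiserFamilyOfClassThresholdUniform`, p724662; this seat's twin with forest and class facts discharged,
`N12MinimiserFamilyAtRecordBjTowerThresholdUniform.hMin_atRecord_Bj_of_printLetters_ofClassThresholdUniform`, p726379) turns, per (instance, height) and per compact set `K` of base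
fields, the per-base-field rows (E) «a (2.12) minimiser `U₀` for the class `U_k({Ω_j(Z)}, εr)` and the datum `M˙(Q_k^{s*}(ext V_k))`» · datum regularity · (δ) «`U₀` bondwise `δc`-flat
near `Ω₁(Z)`» · (T1@q₀) «[15] Thm 1's uniqueness modulo tower-central gauges over the closure of the class» into [IV] Prop. 1's OUTPUT: an `R > 0` and, for every `V_k ∈ K`, a family
`Ũ` of (2.12) minimisers for all data `M˙(Q_k^{s*}(e^{iB′}·ext(e^{ip}·V_k)))`, `‖p‖, ‖B′‖ < R`, holomorphic and bounded by `𝓐₀` on the complex ball.  dag-n12-w6 g17 INHABITED the rows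
at the FLAT base field `V_k ≡ 1` with `U₀ := 1` (`N12Thm1RowAtFlatDatum`: `ext 1 = 1`; `1 ∈` class; `A(U) ≤ A(1) = 0` ⇒ holonomy-flat ⇒ rigidity by tower-central gauges), and dag-n12-w6
g11 inhabited the per-height letters `ρ″`∕`hsbU`∕`εH`∕`B`∕`hHB` (`N12HsurjOfClass.exists_hsurjLetters`).  THIS FILE composes the three: §1 the producer's per-base-field hypothesis at
`K := {1}` is a theorem for every datum tolerance `δ > 0`, gauge tolerance `δc ≥ 0` and class tolerance `εr > 0`; §2 hence the producer's OUTPUT at the flat base field, per-height letters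
displayed; §3 the letters discharged — `ρ″, εH` announced from (instance, height) alone; §4 the five class-tolerance rows folded into ONE announced ceiling `ε₁`:

  ★ `exists_minimiserFamily_near_flatDatum_ofRecord`: for the record numerics (`3 ≤ d`, `1 ≤ k`, `k + 1 ≤ m + K`, `LᵏM₁`-side ∣ `sitesPerDir 0`, `(d+14)L ≤ M₁`) and a scale-`k` block
  union `Z`, THERE IS `ε₁ > 0` such that for every class tolerance `0 < εr ≤ ε₁`, every window `Λ lo hi` with its p. 193 extension `ext`, and every bound `𝓐₀ > 1`, THERE IS `R > 0` and a
  map `Ũ` on (ℂ³)^{bonds_k} × (ℂ³)^{bonds_k}, entrywise holomorphic and bounded by `𝓐₀` on `ball 0 R`, whose values at real `(p, B′)` with `‖p‖, ‖B′‖ < R` are gauge fields `U′` that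
  MINIMISE (2.12) over `U_k({Ω_j(Z)}, εr)` for the datum `M˙(Q_k^{s*}(e^{iB′}·ext(e^{ip}·1)))` on `𝐁_k(Z)`.

That is [IV] Prop. 1 (existence and analyticity of the constrained minimiser as a function of the data) IN THE SMALL around the flat base field — a kernel theorem with no displayed
analytic hypothesis: the A2 ∕ BC5-style certificate, in OUTPUT form, that the (J0′) pipeline of record (w1-lineage chart theorem → U2 → (A″)) is non-vacuous (lane word dag-n12-c g26,
2026-08-29: «`hbase` of `…_threshold_uniform` at `K := {1}` … is the BC5-style non-vacuity certificate of (J0′) OF RECORD»).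

HONEST FRAMING ∕ NOT CLAIMED.  Prop. 1 at a GENERAL base field of the guard is NOT proved here — that is exactly the displayed rows (E) ([15] Thm 1 existence — NODE 00 ∕ b11) and
(T1@q₀) ([15] Thm 1 uniqueness — N07 ∕ b11) of the producer, inhabited here only at `V_k ≡ 1`; `R`, `ρ″`, `εH`, `ε₁` are EXISTENCE constants per (instance, height) (census U4: print's
volume-uniform (46)∕(83) and `k`-uniformity NOT claimed); nothing of Bałaban's estimates is asserted; N12 NOT discharged; K1⁹ NOT closed; counts of record unmoved; one finite 𝕋⁴
programme at fixed `ε = L^{-K}` — R4 closes only the conditional rung `BalabanLadder.UV`; no summit statement is proved here and NOT the Yang–Mills mass gap (Clay); nothing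
continuum ∕ ℝ⁴ ∕ OS.
-/

noncomputable section

namespace Summit.QuantumFields.YangMills.BalabanUVNodes.N12MinimiserFamilyAtFlatDatum

open scoped BigOperators Matrix.Norms.L2Operator Topology
open Literature.MathematicalPhysics.QuantumFieldTheory.Balaban1983to89
open T4Continuum
open B15DeterminingSets GaugeField
open ExpMeanLog (expMeanLogSU deltaSU deltaSU_pos)
open T4AdjointCovarianceUnitary (lieSU)
open Node00
open B15Prop1AnalyticExtClause (cplxVec)
open B15Prop1ChartCalculusSU2 (E3)
open T4CubeChartGnomonic (SU2)
open B14.Eq213DetSet (Bj maxDomT)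
open B14.Eq213MaximalDomains (side)
open B14.Eq22Determines (IsBlockUnion)
open B14.Eq216Concrete (feeds)
open B5Eq118OneStroke (iterBlockOf)
open B15Eq112TorusCover (lift)
open T4AxialGaugeSmallField (boxPlaqs)
open B15Prop1Carrier (plaqsInside)
open Literature.MathematicalPhysics.QuantumFieldTheory.BalabanImbrieJaffe1984to88.BIJ85Eq453GaugeField (qsstarGIter0)
open B15ShellGauge193 (shellGauge)
open B15Extension193 (extend)
open B16Sect1Backgrounds (toMS expMul)
open B15Prop1ChartSU2 (su2Chart)
open Metric (ball)
open Summit.QuantumFields.YangMills.BalabanUVNodes.N12MinimiserFamilyAtRecordBjTowerThresholdUniform (hMin_atRecord_Bj_of_printLetters_ofClassThresholdUniform)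
open Summit.QuantumFields.YangMills.BalabanUVNodes.N12Thm1RowAtFlatDatum (ext_one plaqSmallOn_one isMinimizer_one_at_flatDatum_ofRecord thm1Row_one_at_flatDatum)
open Summit.QuantumFields.YangMills.BalabanUVNodes.N12HsurjOfClass (exists_hsurjLetters)

variable {F : T4Family} {k : ℕ}



/-! ## §1  The producer's per-base-field hypothesis at `K := {1}` is a theorem (`U₀ := 1`), for every datum ∕ gauge ∕ class tolerance -/

/-- ★ **THE PER-BASE-FIELD ROWS OF «(J0′) OF RECORD» HOLD AT THE FLAT BASE FIELD** — the hypothesis `hbase` of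
`N12MinimiserFamilyAtRecordBjTowerThresholdUniform.hMin_atRecord_Bj_of_printLetters_ofClassThresholdUniform` at the compact set `K := {1}` with `U₀ := 1`, for EVERY datum tolerance
`δ > 0`, gauge tolerance `δc ≥ 0` and class tolerance `εr > 0`: (E) `1` minimises (2.12) over `U_k({Ω_j(Z)}, εr)` for its own datum (dag-n12-w6 `isMinimizer_one_at_flatDatum_ofRecord` at
`ν⟨εreg := εr⟩`); the datum row (`ext 1 = 1`, plaquettes of `1` trivial); (δ) (`‖1 − 1‖ = 0 ≤ δc`); (T1@q₀) over the closure of the class (dag-n12-w6 `thm1Row_one_at_flatDatum`; `4L ≤ M₁`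
from the floor `(d+14)L ≤ M₁`).
[cite: Balaban1985Variational, (2) p.278, Thm 1 p.279; Balaban1985RegularSpaces, (1.7), (1.9) p.77; Balaban1988Convergent, (2.12)–(2.13) pp.256–257; Balaban1989LargeFieldI, p.193 L14–20, Prop. 1 p.194; Balaban1987RG1, (0.2), (0.4) pp.252–253] -/
theorem hbase_singleton_one_of_flatDatumRows (ν : Node00.Stage7Numerics) (Kt : ℕ) (Z : Set (Site (F.P Kt) 0))
    (hkK : k + 1 ≤ (F.P Kt).m + (F.P Kt).K) (hk1 : 1 ≤ k) (hdiv : side (F.P Kt).L ν.M₁ k ∣ (F.P Kt).sitesPerDir 0) (hfloor : ((F.P Kt).d + 14) * (F.P Kt).L ≤ ν.M₁)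
    (Λ : Set (Site (F.P Kt) k)) (lo hi : Fin (F.P Kt).d → ℤ) {δ : ℝ} (hδ : 0 < δ)
    (ext : GaugeField (F.P Kt) k SU2 → GaugeField (F.P Kt) k SU2) (hext : ∀ W, ext W = extend Λ (shellGauge W lo hi) W)
    {εr : ℝ} (hεr : 0 < εr) {δc : ℝ} (hδc0 : 0 ≤ δc) :
    ∀ Vk ∈ ({1} : Set (GaugeField (F.P Kt) k SU2)), ∃ U₀ : GaugeField (F.P Kt) 0 SU2,
      IsMinimizer (Node00.avOfRecord F 2 Kt) (Node00.regMSCoPOfRecord F 2 {ν with εreg := εr} Kt k (maxDomT ν.M₁ Z)) (Bj ν.M₁ Z k)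
        (avgFamily (Node00.avOfRecord F 2 Kt) (qsstarGIter0 k (ext Vk))) U₀ ∧
      PlaqSmallOn (plaqsInside (pts k Z)) δ (ext Vk) ∧
      (∀ q : Plaq (F.P Kt) 0, ((⟨q.src, q.μ⟩ : PBond (F.P Kt) 0) ∈ {b : PBond (F.P Kt) 0 | b.src ∈ maxDomT ν.M₁ Z 1} ∨
          (⟨q.src.shift q.μ, q.ν⟩ : PBond (F.P Kt) 0) ∈ {b : PBond (F.P Kt) 0 | b.src ∈ maxDomT ν.M₁ Z 1} ∨
          (⟨q.src.shift q.ν, q.μ⟩ : PBond (F.P Kt) 0) ∈ {b : PBond (F.P Kt) 0 | b.src ∈ maxDomT ν.M₁ Z 1} ∨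
          (⟨q.src, q.ν⟩ : PBond (F.P Kt) 0) ∈ {b : PBond (F.P Kt) 0 | b.src ∈ maxDomT ν.M₁ Z 1}) →
        ‖((U₀ ⟨q.src, q.μ⟩ : SU2) : Matrix (Fin 2) (Fin 2) ℂ) - 1‖ ≤ δc ∧ ‖((U₀ ⟨q.src.shift q.μ, q.ν⟩ : SU2) : Matrix (Fin 2) (Fin 2) ℂ) - 1‖ ≤ δc ∧
          ‖((U₀ ⟨q.src.shift q.ν, q.μ⟩ : SU2) : Matrix (Fin 2) (Fin 2) ℂ) - 1‖ ≤ δc ∧ ‖((U₀ ⟨q.src, q.ν⟩ : SU2) : Matrix (Fin 2) (Fin 2) ℂ) - 1‖ ≤ δc) ∧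
      (∀ U ∈ closure (Node00.regMSCoPOfRecord F 2 {ν with εreg := εr} Kt k (maxDomT ν.M₁ Z)),
        AgreeOn (Bj ν.M₁ Z k) (avgFamily (Node00.avOfRecord F 2 Kt) U) (avgFamily (Node00.avOfRecord F 2 Kt) (qsstarGIter0 k (ext Vk))) →
        wilsonAction4 U ≤ wilsonAction4 U₀ →
          ∃ u : GaugeTransf (F.P Kt) 0 SU2, (∀ j, j ≤ k → ∀ b ∈ bondsOf (Bj ν.M₁ Z k j), toMS u j b.src = toMS u j b.tgt ∧ ∀ g : SU2, toMS u j b.src * g = g * toMS u j b.src) ∧ gaugeAct u U = U₀) := by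
  intro Vk hVk
  rw [Set.mem_singleton_iff] at hVk
  subst hVk
  have hM4 : 4 * (F.P Kt).L ≤ ν.M₁ := le_trans (Nat.mul_le_mul_right _ (by omega)) hfloor
  have h1 : ∀ b : PBond (F.P Kt) 0, ‖(((1 : GaugeField (F.P Kt) 0 SU2) b : SU2) : Matrix (Fin 2) (Fin 2) ℂ) - 1‖ ≤ δc := fun b => by
    have hb : (((1 : GaugeField (F.P Kt) 0 SU2) b : SU2) : Matrix (Fin 2) (Fin 2) ℂ) = 1 := rfl
    rw [hb, sub_self, norm_zero]
    exact hδc0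
  refine ⟨1, isMinimizer_one_at_flatDatum_ofRecord (F := F) (N := 2) {ν with εreg := εr} hεr k (maxDomT ν.M₁ Z) (Bj ν.M₁ Z k) Λ lo hi ext hext, ?_,
    fun q _ => ⟨h1 _, h1 _, h1 _, h1 _⟩, thm1Row_one_at_flatDatum ν Kt Z hkK hk1 hM4 hdiv Λ lo hi ext hext _⟩
  rw [ext_one Λ lo hi ext hext]
  exact plaqSmallOn_one hδ


/-! ## §2  Hence the producer's OUTPUT at the flat base field: [IV] Prop. 1's analytic minimiser family near `V_k ≡ 1` — per-height letters displayed -/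

/-- ★★★ **[IV] PROP. 1's ANALYTIC FAMILY OF (2.12) MINIMISERS FOR ALL DATA NEAR THE FLAT BASE FIELD, PER (INSTANCE, HEIGHT), PER-HEIGHT LETTERS DISPLAYED** —
`N12MinimiserFamilyAtRecordBjTowerThresholdUniform.hMin_atRecord_Bj_of_printLetters_ofClassThresholdUniform` at `K := {1}` (`isCompact_singleton`), gauge tolerance `δc := 0`, datum
tolerance `δ := ρ″ ∕ (6(d−1)Lᵏ + 1)` (inside the budget `6(d−1)Lᵏ·δ ≤ ρ″`), its per-base-field hypothesis supplied by §1: after the per-height letters `hsbU` (radius `ρ″`) and `hHB`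
(right inverse at `(εH, B)`), for every window `Λ lo hi` with its p. 193 extension `ext`, every bound `𝓐₀ > 1` and every class tolerance `εr` with the producer's five rows, THERE IS
`R > 0` and a map `Ũ`, entrywise holomorphic and bounded by `𝓐₀` on `ball 0 R`, whose values at real `(p, B′)`, `‖p‖, ‖B′‖ < R`, are gauge fields minimising (2.12) over `U_k({Ω_j(Z)}, εr)`
for the datum `M˙(Q_k^{s*}(e^{iB′}·ext(e^{ip}·1)))` on `𝐁_k(Z)`.
[cite: Balaban1989LargeFieldI, (1.74) p.192, p.193 L14–20, Prop. 1 p.194; Balaban1985Variational, (2),(7) p.278, Thm 1 p.279, Sect. C (44)–(48) p.285, (81)–(83) p.290, Sect. G pp.305–307, Prop. 9 (190) p.309; Balaban1985RegularSpaces, (1.7), (1.9) p.77; Balaban1989LargeFieldII, p.357, (1.7)–(1.9) p.358, (1.12)–(1.13) p.359; Balaban1988Convergent, (2.2) p.255, (2.10)–(2.13) pp.256–257; Balaban1985Averaging, Prop. 2 (52)–(54) p.26, (122)–(126) p.36; Balaban1987RG1, (0.4) p.253] -/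
theorem exists_minimiserFamily_near_flatDatum_of_printLetters (ν : Node00.Stage7Numerics) (Kt : ℕ) (hd3 : 3 ≤ (F.P Kt).d) (Z : Set (Site (F.P Kt) 0))
    (hkK : k + 1 ≤ (F.P Kt).m + (F.P Kt).K) (hk1 : 1 ≤ k) (hdiv : side (F.P Kt).L ν.M₁ k ∣ (F.P Kt).sitesPerDir 0) (hfloor : ((F.P Kt).d + 14) * (F.P Kt).L ≤ ν.M₁) (hZblk : IsBlockUnion k Z)
    -- the per-HEIGHT letters (EXISTENCE constants per (instance, height); discharged in §3 by dag-n12-w6's `N12HsurjOfClass.exists_hsurjLetters`)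
    {ρ'' : ℝ} (hsbU : ∀ W : GaugeField (F.P Kt) 0 SU2, ‖coeField W - 1‖ ≤ ρ'' → SmallBelow (Node00.avOfRecord F 2 Kt) k W) (hρ : 0 < ρ'')
    {εH B : ℝ}
    (hHB : ∀ (Wd : MSField (F.P Kt) SU2) (U₀ : GaugeField (F.P Kt) 0 SU2),
      AgreeOn (Bj ν.M₁ Z k) (avgFamily (avOfRecord F 2 Kt) U₀) Wd →
      (∀ i' : Fin (constrCard (Bj ν.M₁ Z k) k), ∃ U' : GaugeField (F.P Kt) 0 SU2,
        (∀ b ∈ feeds (((constrEnum (Bj ν.M₁ Z k) k).symm i').1 : ℕ) ((constrEnum (Bj ν.M₁ Z k) k).symm i').2.1, U' b = U₀ b) ∧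
          SmallBelow (avOfRecord F 2 Kt) k U') →
      (∀ (j : ℕ), 1 ≤ j → j ≤ k → ∀ y : Site (F.P Kt) j, embIter j y ∈ maxDomT ν.M₁ Z j → ∃ U' : GaugeField (F.P Kt) 0 SU2,
        (∀ c : PBond (F.P Kt) j, (c.src = y ∨ c.tgt = y) → ∀ b₀ : PBond (F.P Kt) 0,
          (iterBlockOf j b₀.src = c.src ∨ iterBlockOf j b₀.src = c.tgt) → (iterBlockOf j b₀.tgt = c.src ∨ iterBlockOf j b₀.tgt = c.tgt) → U' b₀ = U₀ b₀) ∧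
        SmallBelow (avOfRecord F 2 Kt) k U') →
      (∀ (j : ℕ), 1 ≤ j → j ≤ k → ∀ y : Site (F.P Kt) j, embIter j y ∈ maxDomT ν.M₁ Z j →
        PlaqSmallOn (boxPlaqs (fun κ => lift (F.P Kt) (embIter j y) κ - ((((F.P Kt).L ^ j : ℕ) : ℤ) + ((((F.P Kt).L ^ j - 1) / 2 : ℕ) : ℤ)))
          (fun κ => lift (F.P Kt) (embIter j y) κ + ((((F.P Kt).L ^ j : ℕ) : ℤ) + ((((F.P Kt).L ^ j - 1) / 2 : ℕ) : ℤ))) : Set (Plaq (F.P Kt) 0)) εH U₀) →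
      ∃ H : (Fin (constrCard (Bj ν.M₁ Z k) k) → lieSU (Fin 2)) → PBond (F.P Kt) 0 → lieSU (Fin 2),
        (∀ v, fderiv ℝ (msChart F 2 Kt k (Bj ν.M₁ Z k) Wd U₀) 0 (H v) = v) ∧ ∀ v, Real.sqrt (∑ b, ‖H v b‖ ^ 2) ≤ B * ‖v‖) (hB0 : 0 ≤ B) :
    -- the window, its p. 193 extension, the bound, the class tolerance with the producer's five rows
    ∀ (Λ : Set (Site (F.P Kt) k)) (lo hi : Fin (F.P Kt).d → ℤ)
      (ext : GaugeField (F.P Kt) k SU2 → GaugeField (F.P Kt) k SU2), (∀ W, ext W = extend Λ (shellGauge W lo hi) W) →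
    ∀ {𝓐₀ : ℝ}, 1 < 𝓐₀ →
    ∀ (εr : ℝ), 0 < εr → 12 * ((((F.P Kt).d - 1 : ℕ)) : ℝ) * (F.P Kt).L * εr ≤ ρ'' → εr ≤ εH →
      (143 * (((((F.P Kt).d + 4 : ℕ) : ℝ)) ^ 2 / 4) ^ 2) * (2 * ((F.P Kt).L : ℝ) ^ 2 * εr) ≤ 1 / 3 →
      2 * (2 * ((F.P Kt).L : ℝ) ^ 2 * εr) ≤ 2 * deltaSU (Fin 2) / ((((F.P Kt).d + 4) * (F.P Kt).L : ℕ) : ℝ) ^ 2 →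
    ∃ R : ℝ, 0 < R ∧
      ∃ Ũ : VecField (F.P Kt) k (EuclideanSpace ℂ (Fin 3)) × VecField (F.P Kt) k (EuclideanSpace ℂ (Fin 3)) → PBond (F.P Kt) 0 → Matrix (Fin 2) (Fin 2) ℂ,
        (∀ b i j, DifferentiableOn ℂ (fun z => Ũ z b i j) (ball 0 R)) ∧
        (∀ z ∈ ball (0 : VecField (F.P Kt) k (EuclideanSpace ℂ (Fin 3)) × VecField (F.P Kt) k (EuclideanSpace ℂ (Fin 3))) R, ∀ b i j, ‖Ũ z b i j‖ ≤ 𝓐₀) ∧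
        ∀ p B' : VecField (F.P Kt) k E3, ‖p‖ < R → ‖B'‖ < R → ∃ U' : GaugeField (F.P Kt) 0 SU2,
          (∀ b, Ũ (cplxVec p, cplxVec B') b = ((U' b : SU2) : Matrix (Fin 2) (Fin 2) ℂ)) ∧
            IsMinimizer (Node00.avOfRecord F 2 Kt) (Node00.regMSCoPOfRecord F 2 {ν with εreg := εr} Kt k (maxDomT ν.M₁ Z)) (Bj ν.M₁ Z k)
              (avgFamily (Node00.avOfRecord F 2 Kt) (qsstarGIter0 k (expMul su2Chart B' (ext (expMul su2Chart p 1))))) U' := by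
  intro Λ lo hi ext hext 𝓐₀ h𝓐₀ εr hεr hερ hεH hα3 hα2
  obtain ⟨δ₀, hδ₀, h⟩ := hMin_atRecord_Bj_of_printLetters_ofClassThresholdUniform ν Kt hd3 Z hkK hk1 hdiv hfloor hZblk hsbU hρ hHB hB0
  -- the datum tolerance `δ := ρ″ / (6(d−1)Lᵏ + 1)` lies inside the budget `6(d−1)Lᵏ·δ ≤ ρ″`
  have hc0 : (0 : ℝ) ≤ 6 * ((((F.P Kt).d - 1 : ℕ)) : ℝ) * (F.P Kt).L ^ k := by positivity
  have hδ : (0 : ℝ) < ρ'' / (6 * ((((F.P Kt).d - 1 : ℕ)) : ℝ) * (F.P Kt).L ^ k + 1) := div_pos hρ (by positivity)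
  have hδρ : 6 * ((((F.P Kt).d - 1 : ℕ)) : ℝ) * (F.P Kt).L ^ k * (ρ'' / (6 * ((((F.P Kt).d - 1 : ℕ)) : ℝ) * (F.P Kt).L ^ k + 1)) ≤ ρ'' := by
    rw [← mul_div_assoc, div_le_iff₀ (by positivity)]
    nlinarith
  obtain ⟨R, hR, hfam⟩ := h Λ lo hi hδ hδρ ext hext (isCompact_singleton (x := (1 : GaugeField (F.P Kt) k SU2))) h𝓐₀ εr hεr hερ hεH hα3 hα2 le_rfl hδ₀.le
    (hbase_singleton_one_of_flatDatumRows ν Kt Z hkK hk1 hdiv hfloor Λ lo hi hδ ext hext hεr le_rfl)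
  exact ⟨R, hR, hfam 1 (Set.mem_singleton _)⟩


/-! ## §3  The per-height letters discharged (dag-n12-w6 `exists_hsurjLetters`): `ρ″, εH` announced from (instance, height) alone -/

/-- ★★★ **[IV] PROP. 1's ANALYTIC MINIMISER FAMILY NEAR THE FLAT BASE FIELD — NO LETTER DISPLAYED**: §2 with the radius letter `hsbU` and the right-inverse letter `hHB` DISCHARGED by
dag-n12-w6's `N12HsurjOfClass.exists_hsurjLetters` (at `M₁ := ν.M₁`): from the record numerics alone there are `ρ″, εH > 0` such that, for every window `Λ lo hi` with its p. 193
extension, every `𝓐₀ > 1` and every class tolerance `εr` with the five rows (`0 < εr`, `12(d−1)L·εr ≤ ρ″`, `εr ≤ εH`, [4] Prop. 2's two smallness rows at `α₀ = 2L²εr`), THERE IS `R > 0`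
and the holomorphic, `𝓐₀`-bounded family `Ũ` of §2 of (2.12) minimisers for all data near `ext(1)`.
[cite: Balaban1989LargeFieldI, Prop. 1 p.194, p.193 L14–20; Balaban1985Variational, Thm 1 p.279, Sect. C (44)–(48) p.285, (81)–(83) p.290, Prop. 9 (190) p.309; Balaban1985Averaging, Prop. 2 (52)–(54) p.26, (122)–(126) p.36; Balaban1988Convergent, (2.10)–(2.13) pp.256–257] -/
theorem exists_minimiserFamily_near_flatDatum (ν : Node00.Stage7Numerics) (Kt : ℕ) (hd3 : 3 ≤ (F.P Kt).d) (Z : Set (Site (F.P Kt) 0))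
    (hkK : k + 1 ≤ (F.P Kt).m + (F.P Kt).K) (hk1 : 1 ≤ k) (hdiv : side (F.P Kt).L ν.M₁ k ∣ (F.P Kt).sitesPerDir 0) (hfloor : ((F.P Kt).d + 14) * (F.P Kt).L ≤ ν.M₁)
    (hZblk : IsBlockUnion k Z) :
    ∃ ρ'' εH : ℝ, 0 < ρ'' ∧ 0 < εH ∧
    ∀ (Λ : Set (Site (F.P Kt) k)) (lo hi : Fin (F.P Kt).d → ℤ)
      (ext : GaugeField (F.P Kt) k SU2 → GaugeField (F.P Kt) k SU2), (∀ W, ext W = extend Λ (shellGauge W lo hi) W) →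
    ∀ {𝓐₀ : ℝ}, 1 < 𝓐₀ →
    ∀ (εr : ℝ), 0 < εr → 12 * ((((F.P Kt).d - 1 : ℕ)) : ℝ) * (F.P Kt).L * εr ≤ ρ'' → εr ≤ εH →
      (143 * (((((F.P Kt).d + 4 : ℕ) : ℝ)) ^ 2 / 4) ^ 2) * (2 * ((F.P Kt).L : ℝ) ^ 2 * εr) ≤ 1 / 3 →
      2 * (2 * ((F.P Kt).L : ℝ) ^ 2 * εr) ≤ 2 * deltaSU (Fin 2) / ((((F.P Kt).d + 4) * (F.P Kt).L : ℕ) : ℝ) ^ 2 →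
    ∃ R : ℝ, 0 < R ∧
      ∃ Ũ : VecField (F.P Kt) k (EuclideanSpace ℂ (Fin 3)) × VecField (F.P Kt) k (EuclideanSpace ℂ (Fin 3)) → PBond (F.P Kt) 0 → Matrix (Fin 2) (Fin 2) ℂ,
        (∀ b i j, DifferentiableOn ℂ (fun z => Ũ z b i j) (ball 0 R)) ∧
        (∀ z ∈ ball (0 : VecField (F.P Kt) k (EuclideanSpace ℂ (Fin 3)) × VecField (F.P Kt) k (EuclideanSpace ℂ (Fin 3))) R, ∀ b i j, ‖Ũ z b i j‖ ≤ 𝓐₀) ∧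
        ∀ p B' : VecField (F.P Kt) k E3, ‖p‖ < R → ‖B'‖ < R → ∃ U' : GaugeField (F.P Kt) 0 SU2,
          (∀ b, Ũ (cplxVec p, cplxVec B') b = ((U' b : SU2) : Matrix (Fin 2) (Fin 2) ℂ)) ∧
            IsMinimizer (Node00.avOfRecord F 2 Kt) (Node00.regMSCoPOfRecord F 2 {ν with εreg := εr} Kt k (maxDomT ν.M₁ Z)) (Bj ν.M₁ Z k)
              (avgFamily (Node00.avOfRecord F 2 Kt) (qsstarGIter0 k (expMul su2Chart B' (ext (expMul su2Chart p 1))))) U' := by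
  obtain ⟨ρ'', εH, hρ, hεH0, hsbU, hH⟩ := exists_hsurjLetters (F := F) (k := k) Kt hkK
  have hM1 : 1 ≤ ν.M₁ := by
    have hL := (F.P Kt).L_pos
    nlinarith
  obtain ⟨B, hB0, hHB⟩ := hH ν.M₁ hM1 Z hdiv
  refine ⟨ρ'', εH, hρ, hεH0, ?_⟩
  intro Λ lo hi ext hext 𝓐₀ h𝓐₀ εr hεr hερ hεH hα3 hα2
  exact exists_minimiserFamily_near_flatDatum_of_printLetters ν Kt hd3 Z hkK hk1 hdiv hfloor hZblk hsbU hρ hHB hB0 Λ lo hi ext hext h𝓐₀ εr hεr hερ hεH hα3 hα2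


/-! ## §4  The five class-tolerance rows folded into ONE announced ceiling `ε₁` -/

/-- ★★★★ **[IV] PROP. 1 IN THE SMALL AROUND THE FLAT BASE FIELD, INPUTS OF RECORD ONLY**: for the record numerics `3 ≤ d`, `1 ≤ k`, `k + 1 ≤ m + K`, `LᵏM₁`-side ∣ `sitesPerDir 0`,
`(d+14)L ≤ M₁` and a scale-`k` block union `Z`, THERE IS a class-tolerance ceiling `ε₁ > 0` (the minimum of `ρ″∕(12(d−1)L)`, `εH`, `1∕(3·143·((d+4)²∕4)²·2L²)` and
`deltaSU(2)∕(((d+4)L)²·2L²)`) such that for every `0 < εr ≤ ε₁`, every window `Λ lo hi` with its p. 193 extension `ext` and every bound `𝓐₀ > 1`, THERE IS `R > 0` and a map `Ũ`,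
entrywise holomorphic and bounded by `𝓐₀` on `ball 0 R`, whose values at real `(p, B′)`, `‖p‖, ‖B′‖ < R`, are gauge fields `U′` minimising (2.12) over `U_k({Ω_j(Z)}, εr)` for the datum
`M˙(Q_k^{s*}(e^{iB′}·ext(e^{ip}·1)))` on `𝐁_k(Z)` — the (J0′) pipeline of record, CLOSED at the flat base field.
[cite: Balaban1989LargeFieldI, Prop. 1 p.194, (1.74) p.192, p.193 L14–20; Balaban1985Variational, (2)–(4),(7) p.278, Thm 1 p.279, Sect. C (44)–(48) p.285, (81)–(83) p.290, Sect. G pp.305–307, Prop. 9 (190) p.309; Balaban1985RegularSpaces, (1.7), (1.9) p.77; Balaban1989LargeFieldII, (1.12)–(1.13) p.359; Balaban1988Convergent, (2.2) p.255, (2.10)–(2.13) pp.256–257; Balaban1985Averaging, Prop. 2 (52)–(54) p.26; Balaban1987RG1, (0.2), (0.4) pp.252–253] -/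
theorem exists_minimiserFamily_near_flatDatum_ofRecord (ν : Node00.Stage7Numerics) (Kt : ℕ) (hd3 : 3 ≤ (F.P Kt).d) (Z : Set (Site (F.P Kt) 0))
    (hkK : k + 1 ≤ (F.P Kt).m + (F.P Kt).K) (hk1 : 1 ≤ k) (hdiv : side (F.P Kt).L ν.M₁ k ∣ (F.P Kt).sitesPerDir 0) (hfloor : ((F.P Kt).d + 14) * (F.P Kt).L ≤ ν.M₁)
    (hZblk : IsBlockUnion k Z) :
    ∃ ε₁ : ℝ, 0 < ε₁ ∧ ∀ (εr : ℝ), 0 < εr → εr ≤ ε₁ →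
    ∀ (Λ : Set (Site (F.P Kt) k)) (lo hi : Fin (F.P Kt).d → ℤ)
      (ext : GaugeField (F.P Kt) k SU2 → GaugeField (F.P Kt) k SU2), (∀ W, ext W = extend Λ (shellGauge W lo hi) W) →
    ∀ {𝓐₀ : ℝ}, 1 < 𝓐₀ →
    ∃ R : ℝ, 0 < R ∧
      ∃ Ũ : VecField (F.P Kt) k (EuclideanSpace ℂ (Fin 3)) × VecField (F.P Kt) k (EuclideanSpace ℂ (Fin 3)) → PBond (F.P Kt) 0 → Matrix (Fin 2) (Fin 2) ℂ,
        (∀ b i j, DifferentiableOn ℂ (fun z => Ũ z b i j) (ball 0 R)) ∧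
        (∀ z ∈ ball (0 : VecField (F.P Kt) k (EuclideanSpace ℂ (Fin 3)) × VecField (F.P Kt) k (EuclideanSpace ℂ (Fin 3))) R, ∀ b i j, ‖Ũ z b i j‖ ≤ 𝓐₀) ∧
        ∀ p B' : VecField (F.P Kt) k E3, ‖p‖ < R → ‖B'‖ < R → ∃ U' : GaugeField (F.P Kt) 0 SU2,
          (∀ b, Ũ (cplxVec p, cplxVec B') b = ((U' b : SU2) : Matrix (Fin 2) (Fin 2) ℂ)) ∧
            IsMinimizer (Node00.avOfRecord F 2 Kt) (Node00.regMSCoPOfRecord F 2 {ν with εreg := εr} Kt k (maxDomT ν.M₁ Z)) (Bj ν.M₁ Z k)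
              (avgFamily (Node00.avOfRecord F 2 Kt) (qsstarGIter0 k (expMul su2Chart B' (ext (expMul su2Chart p 1))))) U' := by
  obtain ⟨ρ'', εH, hρ, hεH0, h⟩ := exists_minimiserFamily_near_flatDatum ν Kt hd3 Z hkK hk1 hdiv hfloor hZblk
  -- the four ceilings
  have hd1 : (0 : ℝ) < ((((F.P Kt).d - 1 : ℕ)) : ℝ) := by exact_mod_cast (show 0 < (F.P Kt).d - 1 by omega)
  have hL : (0 : ℝ) < ((F.P Kt).L : ℝ) := by exact_mod_cast (F.P Kt).L_pos
  have hD : (0 : ℝ) < ((((F.P Kt).d + 4) * (F.P Kt).L : ℕ) : ℝ) := by exact_mod_cast Nat.mul_pos (by omega) (F.P Kt).L_pos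
  have hδS : 0 < deltaSU (Fin 2) := deltaSU_pos
  have hc1 : (0 : ℝ) < 12 * ((((F.P Kt).d - 1 : ℕ)) : ℝ) * (F.P Kt).L := by positivity
  have hc3 : (0 : ℝ) < (143 * (((((F.P Kt).d + 4 : ℕ) : ℝ)) ^ 2 / 4) ^ 2) * (2 * ((F.P Kt).L : ℝ) ^ 2) := by positivity
  have hc4 : (0 : ℝ) < ((((F.P Kt).d + 4) * (F.P Kt).L : ℕ) : ℝ) ^ 2 * (2 * ((F.P Kt).L : ℝ) ^ 2) := by positivity
  refine ⟨min (min (ρ'' / (12 * ((((F.P Kt).d - 1 : ℕ)) : ℝ) * (F.P Kt).L)) εH)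
      (min (1 / (3 * ((143 * (((((F.P Kt).d + 4 : ℕ) : ℝ)) ^ 2 / 4) ^ 2) * (2 * ((F.P Kt).L : ℝ) ^ 2))))
        (deltaSU (Fin 2) / (((((F.P Kt).d + 4) * (F.P Kt).L : ℕ) : ℝ) ^ 2 * (2 * ((F.P Kt).L : ℝ) ^ 2)))),
    lt_min (lt_min (div_pos hρ hc1) hεH0) (lt_min (by positivity) (div_pos hδS hc4)), ?_⟩
  intro εr hεr hε1 Λ lo hi ext hext 𝓐₀ h𝓐₀
  have h1 : εr ≤ ρ'' / (12 * ((((F.P Kt).d - 1 : ℕ)) : ℝ) * (F.P Kt).L) := hε1.trans ((min_le_left _ _).trans (min_le_left _ _))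
  have h2 : εr ≤ εH := hε1.trans ((min_le_left _ _).trans (min_le_right _ _))
  have h3 : εr ≤ 1 / (3 * ((143 * (((((F.P Kt).d + 4 : ℕ) : ℝ)) ^ 2 / 4) ^ 2) * (2 * ((F.P Kt).L : ℝ) ^ 2))) :=
    hε1.trans ((min_le_right _ _).trans (min_le_left _ _))
  have h4 : εr ≤ deltaSU (Fin 2) / (((((F.P Kt).d + 4) * (F.P Kt).L : ℕ) : ℝ) ^ 2 * (2 * ((F.P Kt).L : ℝ) ^ 2)) :=
    hε1.trans ((min_le_right _ _).trans (min_le_right _ _))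
  refine h Λ lo hi ext hext h𝓐₀ εr hεr ?_ h2 ?_ ?_
  · -- `12(d−1)L·εr ≤ ρ″`
    have h1' := (le_div_iff₀ hc1).mp h1
    linarith
  · -- `143·((d+4)²/4)²·(2L²·εr) ≤ 1/3`
    have h3' := (le_div_iff₀ (by positivity : (0 : ℝ) < 3 * ((143 * (((((F.P Kt).d + 4 : ℕ) : ℝ)) ^ 2 / 4) ^ 2) * (2 * ((F.P Kt).L : ℝ) ^ 2)))).mp h3
    nlinarith
  · -- `2·(2L²·εr) ≤ 2·deltaSU(2)/((d+4)L)²`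
    have h4' := (le_div_iff₀ hc4).mp h4
    rw [le_div_iff₀ (by positivity)]
    nlinarith

end Summit.QuantumFields.YangMills.BalabanUVNodes.N12MinimiserFamilyAtFlatDatum

end
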